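import Mathlib
import Summits.Ventures.PercRepro2.HCov
import Summits.Ventures.PercRepro2.RootLeafUHalf
import Summits.Ventures.PercRepro2.RootLeafUTheorem
import Summits.Ventures.PercRepro2.RootLeafUMixK
import Summits.Ventures.PercRepro2.RootLeafUMixKA
import Summits.Ventures.PercRepro2.RootLeafUMixL
import Summits.Ventures.PercRepro2.RootLeafUMixLA

/-!
# (G4-u): THE SUM CRITERION — `0 ≤ T2`, hence (HCOV) for a root pendant at an unmarked `u`, on the
class «`lowK / P₀ + lowL / W ≥ 0`» (one half of `T2` pays for the other)
(blind cell PercRepro2, p4 g14; S3 item (aa); no definitions)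

RootLeafUMixClass proves `0 ≤ T2 = T2oL + T2oK` on the class where BOTH one-sided criteria hold,
`(2β − A)·ℋ′ ≤ ℰ·(e0P₀ − d0P_o)` (the `o ∈ K` half) and `(2β + B)·δ_o ≤ (OU)·Y` (the `o ∈ L` half).
But `0 ≤ T2` only needs the SUM of the two halves: the two one-sided lower bounds

  `lowK := (A − 2β)·ℋ′ + ℰ·(e0P₀ − d0P_o) ≤ P₀·T2oK`   (`lowK_le_P0_mul_T2oK`: the master identity
  `P0_mul_T2oK_eq` + the ρ = 1 BHK step `HoK_add_Xb_nonneg`),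
  `lowL := (|B| − 2β)·δ_o + (OU)·Y ≤ W·T2oL`            (`lowL_le_W_mul_T2oL`: the mirror identity
  `W_mul_T2oL_eq` + the BHK step `cov_bnotL_le`),

give `lowK / P₀ ≤ T2oK` and `lowL / W ≤ T2oL` in EVERY case (`lowK_div_le_T2oK`, `lowL_div_le_T2oL`:
when `P₀ = 0` every `PD`/`T′` mass vanishes, `T2oK = ℰ·e0 ≥ 0` and `lowK / 0 = 0`; when `W = 0`,
`T2oL = 0` and `lowL / 0 = 0`), hence

* **`T2_nonneg_of_sum_criterion`**: `0 ≤ lowK / P₀ + lowL / W → 0 ≤ T2`;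
* **`HCov_root_leaf_u_of_sum_criterion`**: (G4-u) — (HCOV) at `(o, a₁, a₂, c, b)` for `a₁` pendant at `u`
  from (HCOV) at the smaller instance `(o, u, a₂, c, b)` — on that class.

The class CONTAINS the class of RootLeafUMixClass (`lowK ≥ 0 ∧ lowL ≥ 0 ⟹ lowK / P₀ + lowL / W ≥ 0`)
and is strictly larger: on 900 random instances n ≤ 7 (three palettes, own code sumclass.py) both
one-sided criteria hold on 78–84 %, the sum criterion on 82–88 %.  Here `P₀ = D + t′ = P(Q, c ∉ K)`,
`W = D + t = P(Q, c ∉ L)`, `A = α + κ`, `B = α − κ ≤ 0`, `β = S·D + d0·Z`, `ℋ′ = t′·P(PD,oK) − D·P(T′,oK)`,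
`δ_o = t·Y_N − D·Y_t`, `(OU) = T2oL(o := u)`, `Y = Y_N + Y_t` (RootLeafUHalf / RootLeafUMixK / RootLeafUMixL).
-/

namespace Summit.Ventures.PercRepro2

open UnionCluster CovForm

namespace RootLeafU

namespace MixK

variable {V : Type*} {E : Type*} [Fintype E] [DecidableEq E] [Fintype V] [DecidableEq V]
  {R : Type*} [Field R] [LinearOrder R] [IsStrictOrderedRing R]

section LowerBound

variable (p : E → R) (ends : E → Sym2 V) (o a₂ c b u : V)

/-- **The one-sided lower bound of the `o ∈ K` half**: `lowK = (A − 2β)·ℋ′ + ℰ·(e0P₀ − d0P_o) ≤ P₀·T2oK`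
(the master identity `P0_mul_T2oK_eq` and the ρ = 1 BHK step `0 ≤ ℋ′ + X_b`). -/
theorem lowK_le_P0_mul_T2oK (hp : IsProbVec p) :
    (((prob p (PDEvent ends u a₂ c) * prob p (connEvent ends a₂ b) +
            prob p (avoidAll ends a₂ {c}) * gap p ends u a₂ b) +
          (prob p Set.univ * EQb3 p ends u a₂ c b + prob p Set.univ * PDb p ends u a₂ c b +
            prob p (connEvent ends a₂ b) * EQ3 p ends u a₂ c +
            prob p (connEvent ends a₂ b) * prob p (avoidAll ends a₂ {u}) -
            (prob p Set.univ - prob p (avoidAll ends a₂ {c})) * gap p ends u a₂ b)) -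
        2 * (prob p Set.univ * prob p (PDEvent ends u a₂ c) +
          prob p (avoidAll ends a₂ {c}) * prob p (avoidAll ends a₂ {u}))) *
        (prob p (TEvent ends a₂ u c) * prob p (PDEvent ends u a₂ c ∩ connEvent ends a₂ o) -
          prob p (PDEvent ends u a₂ c) * prob p (TEvent ends a₂ u c ∩ connEvent ends a₂ o)) +
      Ee p ends a₂ c b u *
        (prob p (avoidAll ends a₂ {c} ∩ connEvent ends a₂ o) *
            (prob p (PDEvent ends u a₂ c) + prob p (TEvent ends a₂ u c)) -
          prob p (avoidAll ends a₂ {c}) *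
            (prob p (PDEvent ends u a₂ c ∩ connEvent ends a₂ o) +
              prob p (TEvent ends a₂ u c ∩ connEvent ends a₂ o))) ≤
    (prob p (PDEvent ends u a₂ c) + prob p (TEvent ends a₂ u c)) * T2oK p ends o a₂ c b u := by
  have hid := P0_mul_T2oK_eq p ends o a₂ c b u
  have hHX := HoK_add_Xb_nonneg p ends o a₂ c b u hp
  have hβ : 0 ≤ prob p Set.univ * prob p (PDEvent ends u a₂ c) +
      prob p (avoidAll ends a₂ {c}) * prob p (avoidAll ends a₂ {u}) :=
    add_nonneg (mul_nonneg (prob_nonneg hp _) (prob_nonneg hp _))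
      (mul_nonneg (prob_nonneg hp _) (prob_nonneg hp _))
  rw [hid]
  nlinarith [mul_nonneg hβ hHX]

/-- **`lowK / P₀ ≤ T2oK` in every case**: for `P₀ > 0` from `lowK_le_P0_mul_T2oK`; for `P₀ = 0` every
`PD`/`T′` mass vanishes, `T2oK = ℰ·e0 ≥ 0` and `lowK / 0 = 0`. -/
theorem lowK_div_le_T2oK (hp : IsProbVec p) :
    ((((prob p (PDEvent ends u a₂ c) * prob p (connEvent ends a₂ b) +
            prob p (avoidAll ends a₂ {c}) * gap p ends u a₂ b) +
          (prob p Set.univ * EQb3 p ends u a₂ c b + prob p Set.univ * PDb p ends u a₂ c b +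
            prob p (connEvent ends a₂ b) * EQ3 p ends u a₂ c +
            prob p (connEvent ends a₂ b) * prob p (avoidAll ends a₂ {u}) -
            (prob p Set.univ - prob p (avoidAll ends a₂ {c})) * gap p ends u a₂ b)) -
        2 * (prob p Set.univ * prob p (PDEvent ends u a₂ c) +
          prob p (avoidAll ends a₂ {c}) * prob p (avoidAll ends a₂ {u}))) *
        (prob p (TEvent ends a₂ u c) * prob p (PDEvent ends u a₂ c ∩ connEvent ends a₂ o) -
          prob p (PDEvent ends u a₂ c) * prob p (TEvent ends a₂ u c ∩ connEvent ends a₂ o)) +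
      Ee p ends a₂ c b u *
        (prob p (avoidAll ends a₂ {c} ∩ connEvent ends a₂ o) *
            (prob p (PDEvent ends u a₂ c) + prob p (TEvent ends a₂ u c)) -
          prob p (avoidAll ends a₂ {c}) *
            (prob p (PDEvent ends u a₂ c ∩ connEvent ends a₂ o) +
              prob p (TEvent ends a₂ u c ∩ connEvent ends a₂ o)))) /
      (prob p (PDEvent ends u a₂ c) + prob p (TEvent ends a₂ u c)) ≤ T2oK p ends o a₂ c b u := by
  have hlow := lowK_le_P0_mul_T2oK p ends o a₂ c b u hp
  have hP0 : 0 ≤ prob p (PDEvent ends u a₂ c) + prob p (TEvent ends a₂ u c) :=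
    add_nonneg (prob_nonneg hp _) (prob_nonneg hp _)
  rcases hP0.lt_or_eq with hpos | hzero
  · rw [div_le_iff₀ hpos]
    linarith [hlow]
  · -- `P₀ = 0`: `lowK / 0 = 0` and `T2oK = ℰ·e0 ≥ 0`
    have hz := hzero.symm
    rw [hz, div_zero]
    have hE := Ee_nonneg p ends a₂ c b u hp
    have he0 := prob_nonneg hp (avoidAll ends a₂ {c} ∩ connEvent ends a₂ o)
    unfold T2oK
    have h1 := prob_PD_eq_zero_of_P0 p ends a₂ c u hp hz (connEvent ends a₂ o)
    have h2 := prob_PD_eq_zero_of_P0 p ends a₂ c u hp hz (connEvent ends a₂ o ∩ connEvent ends a₂ b)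
    have h3 := prob_PD_eq_zero_of_P0 p ends a₂ c u hp hz (connEvent ends a₂ o ∩ connEvent ends u b)
    rw [h1.1, h1.2, h2.2, h3.1, h3.2]
    have := mul_nonneg hE he0
    linarith

end LowerBound

end MixK

namespace MixL

variable {V : Type*} {E : Type*} [Fintype E] [DecidableEq E] [Fintype V] [DecidableEq V]
  {R : Type*} [Field R] [LinearOrder R] [IsStrictOrderedRing R]

section LowerBound

variable (p : E → R) (ends : E → Sym2 V) (o a₂ c b u : V)

/-- **The one-sided lower bound of the `o ∈ L` half**: `lowL = (|B| − 2β)·δ_o + (OU)·Y ≤ W·T2oL`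
(`|B| = κ − α`, `δ_o = t·Y_N − D·Y_t`, `(OU) = T2oL(o := u)`, `Y = Y_N + Y_t`; the mirror identity
`W_mul_T2oL_eq` and the BHK step `cov_bnotL_le`). -/
theorem lowL_le_W_mul_T2oL (hp : IsProbVec p) :
    ((prob p Set.univ * EQb3 p ends u a₂ c b + prob p Set.univ * PDb p ends u a₂ c b +
            prob p (connEvent ends a₂ b) * EQ3 p ends u a₂ c +
            prob p (connEvent ends a₂ b) * prob p (avoidAll ends a₂ {u}) -
            (prob p Set.univ - prob p (avoidAll ends a₂ {c})) * gap p ends u a₂ b) -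
          (prob p (PDEvent ends u a₂ c) * prob p (connEvent ends a₂ b) +
            prob p (avoidAll ends a₂ {c}) * gap p ends u a₂ b) -
        2 * (prob p Set.univ * prob p (PDEvent ends u a₂ c) +
          prob p (avoidAll ends a₂ {c}) * prob p (avoidAll ends a₂ {u}))) *
        (prob p (TEvent ends u a₂ c) * prob p (PDEvent ends u a₂ c ∩ connEvent ends u o) -
          prob p (PDEvent ends u a₂ c) * prob p (TEvent ends u a₂ c ∩ connEvent ends u o)) +
      T2oL p ends u a₂ c b u *
        (prob p (PDEvent ends u a₂ c ∩ connEvent ends u o) +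
          prob p (TEvent ends u a₂ c ∩ connEvent ends u o)) ≤
    (prob p (PDEvent ends u a₂ c) + prob p (TEvent ends u a₂ c)) * T2oL p ends o a₂ c b u := by
  have hid := W_mul_T2oL_eq p ends o a₂ c b u
  have hcov := cov_bnotL_le p ends o a₂ c b u hp
  have hβ : 0 ≤ prob p Set.univ * prob p (PDEvent ends u a₂ c) +
      prob p (avoidAll ends a₂ {c}) * prob p (avoidAll ends a₂ {u}) :=
    add_nonneg (mul_nonneg (prob_nonneg hp _) (prob_nonneg hp _))
      (mul_nonneg (prob_nonneg hp _) (prob_nonneg hp _))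
  rw [hid]
  nlinarith [mul_nonneg hβ (sub_nonneg.2 hcov)]

/-- **`lowL / W ≤ T2oL` in every case**: for `W > 0` from `lowL_le_W_mul_T2oL`; for `W = 0` every
`PD`/`T` mass vanishes, `T2oL = 0` and `lowL / 0 = 0`. -/
theorem lowL_div_le_T2oL (hp : IsProbVec p) :
    (((prob p Set.univ * EQb3 p ends u a₂ c b + prob p Set.univ * PDb p ends u a₂ c b +
            prob p (connEvent ends a₂ b) * EQ3 p ends u a₂ c +
            prob p (connEvent ends a₂ b) * prob p (avoidAll ends a₂ {u}) -
            (prob p Set.univ - prob p (avoidAll ends a₂ {c})) * gap p ends u a₂ b) -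
          (prob p (PDEvent ends u a₂ c) * prob p (connEvent ends a₂ b) +
            prob p (avoidAll ends a₂ {c}) * gap p ends u a₂ b) -
        2 * (prob p Set.univ * prob p (PDEvent ends u a₂ c) +
          prob p (avoidAll ends a₂ {c}) * prob p (avoidAll ends a₂ {u}))) *
        (prob p (TEvent ends u a₂ c) * prob p (PDEvent ends u a₂ c ∩ connEvent ends u o) -
          prob p (PDEvent ends u a₂ c) * prob p (TEvent ends u a₂ c ∩ connEvent ends u o)) +
      T2oL p ends u a₂ c b u *
        (prob p (PDEvent ends u a₂ c ∩ connEvent ends u o) +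
          prob p (TEvent ends u a₂ c ∩ connEvent ends u o))) /
      (prob p (PDEvent ends u a₂ c) + prob p (TEvent ends u a₂ c)) ≤ T2oL p ends o a₂ c b u := by
  have hlow := lowL_le_W_mul_T2oL p ends o a₂ c b u hp
  have hW : 0 ≤ prob p (PDEvent ends u a₂ c) + prob p (TEvent ends u a₂ c) :=
    add_nonneg (prob_nonneg hp _) (prob_nonneg hp _)
  rcases hW.lt_or_eq with hpos | hzero
  · rw [div_le_iff₀ hpos]
    linarith [hlow]
  · -- `W = 0`: `lowL / 0 = 0` and `T2oL = 0`
    have hz := hzero.symm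
    rw [hz, div_zero]
    have z : ∀ X : Set (Config E),
        prob p (PDEvent ends u a₂ c ∩ X) = 0 ∧ prob p (TEvent ends u a₂ c ∩ X) = 0 := by
      intro X
      have hD := prob_nonneg hp (PDEvent ends u a₂ c)
      have hT := prob_nonneg hp (TEvent ends u a₂ c)
      have hDX := prob_inter_le_left hp (PDEvent ends u a₂ c) X
      have hTX := prob_inter_le_left hp (TEvent ends u a₂ c) X
      have hDX0 := prob_nonneg hp (PDEvent ends u a₂ c ∩ X)
      have hTX0 := prob_nonneg hp (TEvent ends u a₂ c ∩ X)
      constructor <;> linarith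
    unfold T2oL
    rw [(z (connEvent ends u o)).1, (z (connEvent ends u o)).2,
      (z (connEvent ends u o ∩ connEvent ends u b)).2,
      (z (connEvent ends u o ∩ connEvent ends a₂ b)).1, (z (connEvent ends u o ∩ connEvent ends a₂ b)).2]
    simp

end LowerBound

end MixL

section Theorem

variable {V : Type*} {E : Type*} [Fintype E] [DecidableEq E] [Fintype V] [DecidableEq V]
  {R : Type*} [Field R] [LinearOrder R] [IsStrictOrderedRing R]
variable (p : E → R) (ends : E → Sym2 V) (o a₂ c b u : V)

/-- **`0 ≤ T2` on the class `lowK / P₀ + lowL / W ≥ 0`** — one half of the second coefficient pays for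
the other (contains the class of `T2_nonneg_of_classes`, where both summands are `≥ 0`). -/
theorem T2_nonneg_of_sum_criterion (hp : IsProbVec p)
    (hsum : 0 ≤
      ((((prob p (PDEvent ends u a₂ c) * prob p (connEvent ends a₂ b) +
            prob p (avoidAll ends a₂ {c}) * gap p ends u a₂ b) +
          (prob p Set.univ * EQb3 p ends u a₂ c b + prob p Set.univ * PDb p ends u a₂ c b +
            prob p (connEvent ends a₂ b) * EQ3 p ends u a₂ c +
            prob p (connEvent ends a₂ b) * prob p (avoidAll ends a₂ {u}) -
            (prob p Set.univ - prob p (avoidAll ends a₂ {c})) * gap p ends u a₂ b)) -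
        2 * (prob p Set.univ * prob p (PDEvent ends u a₂ c) +
          prob p (avoidAll ends a₂ {c}) * prob p (avoidAll ends a₂ {u}))) *
        (prob p (TEvent ends a₂ u c) * prob p (PDEvent ends u a₂ c ∩ connEvent ends a₂ o) -
          prob p (PDEvent ends u a₂ c) * prob p (TEvent ends a₂ u c ∩ connEvent ends a₂ o)) +
      Ee p ends a₂ c b u *
        (prob p (avoidAll ends a₂ {c} ∩ connEvent ends a₂ o) *
            (prob p (PDEvent ends u a₂ c) + prob p (TEvent ends a₂ u c)) -
          prob p (avoidAll ends a₂ {c}) *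
            (prob p (PDEvent ends u a₂ c ∩ connEvent ends a₂ o) +
              prob p (TEvent ends a₂ u c ∩ connEvent ends a₂ o)))) /
        (prob p (PDEvent ends u a₂ c) + prob p (TEvent ends a₂ u c)) +
      (((prob p Set.univ * EQb3 p ends u a₂ c b + prob p Set.univ * PDb p ends u a₂ c b +
            prob p (connEvent ends a₂ b) * EQ3 p ends u a₂ c +
            prob p (connEvent ends a₂ b) * prob p (avoidAll ends a₂ {u}) -
            (prob p Set.univ - prob p (avoidAll ends a₂ {c})) * gap p ends u a₂ b) -
          (prob p (PDEvent ends u a₂ c) * prob p (connEvent ends a₂ b) +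
            prob p (avoidAll ends a₂ {c}) * gap p ends u a₂ b) -
        2 * (prob p Set.univ * prob p (PDEvent ends u a₂ c) +
          prob p (avoidAll ends a₂ {c}) * prob p (avoidAll ends a₂ {u}))) *
        (prob p (TEvent ends u a₂ c) * prob p (PDEvent ends u a₂ c ∩ connEvent ends u o) -
          prob p (PDEvent ends u a₂ c) * prob p (TEvent ends u a₂ c ∩ connEvent ends u o)) +
      T2oL p ends u a₂ c b u *
        (prob p (PDEvent ends u a₂ c ∩ connEvent ends u o) +
          prob p (TEvent ends u a₂ c ∩ connEvent ends u o))) /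
        (prob p (PDEvent ends u a₂ c) + prob p (TEvent ends u a₂ c))) :
    0 ≤ T2 p ends o a₂ c b u := by
  have hK := MixK.lowK_div_le_T2oK p ends o a₂ c b u hp
  have hL := MixL.lowL_div_le_T2oL p ends o a₂ c b u hp
  rw [T2_eq_T2oL_add_T2oK]
  linarith

/-- **(G4-u) on the sum class**: (HCOV) for a root `a₁` pendant at the unmarked `u` follows from (HCOV) at
the smaller instance `(o, u, a₂, c, b)` whenever `lowK / P₀ + lowL / W ≥ 0` there. -/
theorem HCov_root_leaf_u_of_sum_criterion (hp : IsProbVec p) {f : E} {a₁ : V} (hf : ends f = s(a₁, u))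
    (hleaf : ∀ e, a₁ ∈ ends e → e = f) (h1u : a₁ ≠ u) (h12 : a₁ ≠ a₂) (h1c : a₁ ≠ c)
    (h1o : a₁ ≠ o) (h1b : a₁ ≠ b)
    (hsum : 0 ≤
      ((((prob p (PDEvent ends u a₂ c) * prob p (connEvent ends a₂ b) +
            prob p (avoidAll ends a₂ {c}) * gap p ends u a₂ b) +
          (prob p Set.univ * EQb3 p ends u a₂ c b + prob p Set.univ * PDb p ends u a₂ c b +
            prob p (connEvent ends a₂ b) * EQ3 p ends u a₂ c +
            prob p (connEvent ends a₂ b) * prob p (avoidAll ends a₂ {u}) -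
            (prob p Set.univ - prob p (avoidAll ends a₂ {c})) * gap p ends u a₂ b)) -
        2 * (prob p Set.univ * prob p (PDEvent ends u a₂ c) +
          prob p (avoidAll ends a₂ {c}) * prob p (avoidAll ends a₂ {u}))) *
        (prob p (TEvent ends a₂ u c) * prob p (PDEvent ends u a₂ c ∩ connEvent ends a₂ o) -
          prob p (PDEvent ends u a₂ c) * prob p (TEvent ends a₂ u c ∩ connEvent ends a₂ o)) +
      Ee p ends a₂ c b u *
        (prob p (avoidAll ends a₂ {c} ∩ connEvent ends a₂ o) *
            (prob p (PDEvent ends u a₂ c) + prob p (TEvent ends a₂ u c)) -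
          prob p (avoidAll ends a₂ {c}) *
            (prob p (PDEvent ends u a₂ c ∩ connEvent ends a₂ o) +
              prob p (TEvent ends a₂ u c ∩ connEvent ends a₂ o)))) /
        (prob p (PDEvent ends u a₂ c) + prob p (TEvent ends a₂ u c)) +
      (((prob p Set.univ * EQb3 p ends u a₂ c b + prob p Set.univ * PDb p ends u a₂ c b +
            prob p (connEvent ends a₂ b) * EQ3 p ends u a₂ c +
            prob p (connEvent ends a₂ b) * prob p (avoidAll ends a₂ {u}) -
            (prob p Set.univ - prob p (avoidAll ends a₂ {c})) * gap p ends u a₂ b) -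
          (prob p (PDEvent ends u a₂ c) * prob p (connEvent ends a₂ b) +
            prob p (avoidAll ends a₂ {c}) * gap p ends u a₂ b) -
        2 * (prob p Set.univ * prob p (PDEvent ends u a₂ c) +
          prob p (avoidAll ends a₂ {c}) * prob p (avoidAll ends a₂ {u}))) *
        (prob p (TEvent ends u a₂ c) * prob p (PDEvent ends u a₂ c ∩ connEvent ends u o) -
          prob p (PDEvent ends u a₂ c) * prob p (TEvent ends u a₂ c ∩ connEvent ends u o)) +
      T2oL p ends u a₂ c b u *
        (prob p (PDEvent ends u a₂ c ∩ connEvent ends u o) +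
          prob p (TEvent ends u a₂ c ∩ connEvent ends u o))) /
        (prob p (PDEvent ends u a₂ c) + prob p (TEvent ends u a₂ c)))
    (h3 : HCov p ends o u a₂ c b) : HCov p ends o a₁ a₂ c b :=
  HCov_root_leaf_u_of p ends hp hf hleaf h1u h12 h1c h1o h1b
    (T2_nonneg_of_sum_criterion p ends o a₂ c b u hp hsum) h3

end Theorem

end RootLeafU

end Summit.Ventures.PercRepro2
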